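/-
Copyright (c) 2026 the pub-hodgecm-mathlib formalisation cell (harness21).  Prover seat hodgecm-mathlib-K2Liu-p09 (g8), Track B «K2-LIT» ∕ hLiu418
#184♮, Road I v3, unit U5 «THE CLOSE», FACE-G letter L2 (G-Θ), residual organ (W-orb), tie route (C2) «closure» (desk K2Liu-p10 (g6) 23:38:33Z
recommendation; SIG K2Liu-p09 (g8) 23:41:40Z).  THEOREMS ONLY.  2026-09-04.
-/
import Summits.HodgeConjecture.HodgeConjecture.Theorems.K2LiuFaceGThetaLetter       -- ★ p863031: `proj_chiSplittingLine_eq_toSp`, `archSkew_diagonal_of_hermD`, the `hWorb` shape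
import Summits.HodgeConjecture.HodgeCM.Model.HypCensus.ArchFactor_2                -- ★ `continuous_archWeilRep` (every `ω_∞(u)` is continuous on `𝓢(X_∞)`)
import Literature.Analysis.FunctionSpaces.SchwartzComplete                         -- ★ `barrelledSpace_schwartzMap` (`𝓢` is Fréchet, hence barrelled)
import Mathlib.Analysis.Calculus.UniformLimitsDeriv
import Mathlib.Analysis.Calculus.Deriv.Shift
import Mathlib.Analysis.LocallyConvex.Barrelled
import HarnessLib

/-!
# K2_Liu road (hLiu418 = stmt-HodgeConjecture-24832), Road I v3, FACE-G letter L2 (G-Θ), organ (W-orb), CLOSURE ROUTE (C2):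
# the weak orbit derivative of a one-parameter group on `𝓢` passes from a DENSE set of vectors to EVERY vector

Cell `pub/hodgecm-mathlib` (D-0151), Track B, build stream 29; helper lane, count-neutral.  ★ `K2LiuFaceGThetaLetter` reduced the FACE-G letter L2 to the
organ (W-orb) «for EVERY `Ψ_∞ ∈ 𝓢(X_∞)` the orbit `t ↦ ω_∞(exp tX, 1) Ψ_∞` of the small pair's archimedean Weil representation is weakly differentiable at
`0` with derivative a Schwartz vector».  The payer's census (LH4-p05 (g10) `CENSUS-Worb.v1` §2) finds the tree's smoothness engine ((G2-W2), (G2-W4b))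
intrinsic to PLACE-PRODUCT vectors; desk K2Liu-p10 (g6) ruled the tie route (C2): pay (W-orb) on products (road (B)) and CLOSE UP to every vector.  THIS
FILE is the closure, as PURE FUNCTIONAL ANALYSIS (no Weil object before §5):

* §1 **`hasDerivAt_orbit_shift`** — for a one-parameter family of continuous linear operators `U t` with `U (t + s) = U t ∘ U s`, the weak derivative law
  AT `0` (`∀ T, HasDerivAt (s ↦ T (U s d)) (T d′) 0`) gives the law AT EVERY `t` (`HasDerivAt (s ↦ T (U s d)) (T (U t d′)) t`): `T ∘ U t` is again a
  continuous linear functional, and `s ↦ s − t` shifts.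
* §2 **`hasDerivAt_orbit_of_mem_closure`** (abstract `E`: uniform additive group, `ℝ`-module) — if the law holds on a set `D` at every `t` with derivative
  operator a continuous linear `A`, and the scalar families `{T ∘ U t : |t| ≤ 1}` are equicontinuous at `0` (`heq`), then the law at `0` holds at every
  `Ψ ∈ closure D` with derivative `T (A Ψ)`: Mathlib's `hasDerivAt_of_tendstoUniformlyOnFilter` along the filter `𝓝[D] Ψ` — the derivatives
  `T (U t (A d))` converge to `T (U t (A Ψ))` UNIFORMLY in `|t| ≤ 1` by `heq` and the continuity of `A`, the functions converge pointwise by the continuity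
  of each `U t`.
* §3 **`equicontinuous_orbit_schwartz`** — on `E := 𝓢(W, ℂ)` the hypothesis `heq` follows from ORBIT CONTINUITY on a compact `K` (`t ↦ U t Ψ` continuous on
  `K` for every `Ψ`): the orbits are bounded in every Schwartz seminorm, so by BANACH–STEINHAUS on the barrelled `𝓢` (★ `barrelledSpace_schwartzMap`,
  Mathlib `WithSeminorms.banach_steinhaus` — the ★ (W-cont) pattern of `Weil1964.AdelicThetaArchContinuity`) the family `{U t : t ∈ K}` is uniformly
  equicontinuous.
* §4 **`hasDerivAt_orbit_schwartz_of_dense`** — §1 + §2 + §3: «a one-parameter group of continuous linear operators on `𝓢` with continuous orbits, whose weak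
  derivative law at `0` holds on a DENSE set `D` with derivative `A d` for a continuous linear `A`, satisfies the law at EVERY vector with derivative `A Ψ`».
* §5 **`thetaOrbitLetter_of_dense`** — §4 at `U t := ω_∞(exp tX, 1)`, `ω_∞ = archWeilRep … (chiSplittingLine …) hs` the small pair's archimedean Weil
  representation (continuous operators ★ `continuous_archWeilRep`; one-parameter law ★ `expGL_add_smul`, `expGL_zero`): from «`D` dense», «`A` with the law
  on `D`» and «orbit continuity in `t`» to the `hWorb` binder of ★ `faceG_thetaLetter_of_archOrbitDeriv` VERBATIM (with `Ψ_∞′ := A Ψ_∞`).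

So under (C2) the (W-orb) residue by name is {(i) density of the class `D` (span of full place-products) in `𝓢(X_∞)`; (ii) the all-variables continuous
operator `A = dω_∞(X)` with the product law on `D` (road (B) globalised); (iii′) orbit continuity `t ↦ ω_∞(exp tX, 1) Ψ` into `𝓢(X_∞)`}.  No definition, no
instance, no notation, no named-fact hypothesis, no `sorry`; axioms ⊆ {propext, Classical.choice, Quot.sound}.  HONEST LABEL: HC_CM is proved only modulo the 7
printed citations (2 remaining named inputs: hLiu418 = stmt-HodgeConjecture-24832, h413 = stmt-HodgeConjecture-24833) until rung 0 closes; this file is a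
`--supports stmt-HodgeConjecture-24832` helper and moves no counter.

References: [Rudin1991] W. Rudin, Functional Analysis, Thm. 2.6 (Banach–Steinhaus), Thm. 2.17, Thm. 7.17 (uniform limits of derivatives); [Folland1989] G. B. Folland,
Harmonic Analysis in Phase Space, §4.2 Prop. (4.39) (smooth vectors of the oscillator representation = `𝓢`); [Weil1964] A. Weil, Acta Math. 111 (1964) Chap. III
n° 39 p. 189 («`S → SΦ` est une application continue»), n° 41 Thm 6 p. 193; [Varadarajan1984] V. S. Varadarajan, Lie Groups, Lie Algebras, and Their
Representations, Thm. 2.10.1.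
-/

set_option autoImplicit false
set_option linter.dupNamespace false
-- statements over the adelic dual-pair carriers (§5) elaborate to very large types; elaborate sequentially (as in ★ F3)
set_option Elab.async false

noncomputable section

open Filter Set Topology
open scoped SchwartzMap

namespace Summit.HodgeConjecture.HodgeConjecture.Cruxes.HLiu418.K2LiuArchOrbitDerivClosure

/-! ## §1 The weak derivative law propagates from `t = 0` along a one-parameter group -/

/-- **LAW AT `0` ⇒ LAW AT EVERY `t`.**  For continuous linear operators `U t` with `U (t + s) = U t ∘ U s` and a vector `d` whose orbit has weak derivative `d′` at
`0` against EVERY continuous linear functional, the orbit has weak derivative `U t d′` at every `t` (apply the law at `0` to the functional `T ∘ U t` and shift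
`s ↦ s − t`). [cite: Varadarajan1984, Thm. 2.10.1] -/
theorem hasDerivAt_orbit_shift {E F : Type*} [AddCommGroup E] [Module ℝ E] [TopologicalSpace E]
    [NormedAddCommGroup F] [NormedSpace ℝ F]
    (U : ℝ → E →L[ℝ] E) (hgrp : ∀ (t s : ℝ) (x : E), U (t + s) x = U t (U s x))
    {d d' : E} (h0 : ∀ T : E →L[ℝ] F, HasDerivAt (fun s : ℝ => T (U s d)) (T d') 0)
    (t : ℝ) (T : E →L[ℝ] F) :
    HasDerivAt (fun s : ℝ => T (U s d)) (T (U t d')) t := by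
  have h1 : HasDerivAt (fun s : ℝ => (T.comp (U t)) (U s d)) ((T.comp (U t)) d') (t - t) := by
    rw [sub_self]
    exact h0 (T.comp (U t))
  have h2 := HasDerivAt.comp_sub_const t t h1
  have hfun : (fun s : ℝ => T (U s d)) = fun s : ℝ => (T.comp (U t)) (U (s - t) d) := by
    funext s
    rw [ContinuousLinearMap.comp_apply, ← hgrp, add_sub_cancel]
  rw [hfun, ← ContinuousLinearMap.comp_apply T (U t)]
  exact h2

/-! ## §2 The closure principle (abstract) -/

/-- **CLOSURE PRINCIPLE FOR WEAK ORBIT DERIVATIVES.**  Let `U t` (`t ∈ ℝ`) be continuous linear operators of a topological vector space `E` with `U 0 = id`,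
`A` a continuous linear operator, `D ⊆ E`.  Suppose (law on `D`) for `d ∈ D`, every `t` and every continuous linear `T : E → F`,
`HasDerivAt (s ↦ T (U s d)) (T (U t (A d))) t`; and (equicontinuity) for every `T` and `ε > 0` some neighbourhood `V` of `0` has `‖T (U t x)‖ < ε` for all
`|t| ≤ 1`, `x ∈ V`.  Then for every `Ψ ∈ closure D` and every `T`: `HasDerivAt (t ↦ T (U t Ψ)) (T (A Ψ)) 0` — uniform convergence of the derivatives along
`𝓝[D] Ψ` (Mathlib `hasDerivAt_of_tendstoUniformlyOnFilter`). [cite: Rudin1991, Thm. 7.17] -/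
theorem hasDerivAt_orbit_of_mem_closure {E F : Type*} [AddCommGroup E] [Module ℝ E] [UniformSpace E] [IsUniformAddGroup E]
    [NormedAddCommGroup F] [NormedSpace ℝ F]
    (U : ℝ → E →L[ℝ] E) (A : E →L[ℝ] E) (D : Set E) {Ψ : E} (hΨ : Ψ ∈ closure D)
    (hlaw : ∀ d ∈ D, ∀ (t : ℝ) (T : E →L[ℝ] F), HasDerivAt (fun s : ℝ => T (U s d)) (T (U t (A d))) t)
    (heq : ∀ (T : E →L[ℝ] F) (ε : ℝ), 0 < ε → ∃ V ∈ 𝓝 (0 : E), ∀ t ∈ Set.Icc (-1 : ℝ) 1, ∀ x ∈ V, ‖T (U t x)‖ < ε)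
    (hU0 : ∀ x : E, U 0 x = x) (T : E →L[ℝ] F) :
    HasDerivAt (fun t : ℝ => T (U t Ψ)) (T (A Ψ)) 0 := by
  haveI : (𝓝[D] Ψ).NeBot := mem_closure_iff_nhdsWithin_neBot.1 hΨ
  have key : HasDerivAt (fun t : ℝ => T (U t Ψ)) ((fun t : ℝ => T (U t (A Ψ))) 0) 0 := by
    refine hasDerivAt_of_tendstoUniformlyOnFilter (l := 𝓝[D] Ψ)
      (f := fun (d : E) (t : ℝ) => T (U t d)) (f' := fun (d : E) (t : ℝ) => T (U t (A d)))
      (g' := fun t : ℝ => T (U t (A Ψ))) ?_ ?_ ?_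
    · -- the derivatives converge uniformly for `|t| ≤ 1`
      rw [Metric.tendstoUniformlyOnFilter_iff]
      intro ε hε
      obtain ⟨V, hV, hVε⟩ := heq T ε hε
      have hA : Tendsto (fun d : E => A Ψ - A d) (𝓝[D] Ψ) (𝓝 0) := by
        have hc : Continuous fun d : E => A Ψ - A d := continuous_const.sub A.continuous
        have h := hc.tendsto Ψ
        rw [sub_self] at h
        exact h.mono_left nhdsWithin_le_nhds
      have h1 : ∀ᶠ d in 𝓝[D] Ψ, A Ψ - A d ∈ V := hA.eventually_mem hV
      have h2 : ∀ᶠ t in 𝓝 (0 : ℝ), t ∈ Set.Icc (-1 : ℝ) 1 := Icc_mem_nhds (by norm_num) (by norm_num)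
      filter_upwards [h1.prod_mk h2] with p hp
      rw [dist_eq_norm, ← map_sub, ← map_sub]
      exact hVε p.2 hp.2 _ hp.1
    · -- the law holds along `D`
      exact ((eventually_mem_nhdsWithin (a := Ψ) (s := D)).prod_inl (𝓝 (0 : ℝ))).mono fun p hp => hlaw p.1 hp p.2 T
    · -- pointwise convergence: each `U t` is continuous
      exact Eventually.of_forall fun y =>
        ((T.continuous.comp (U y).continuous).tendsto Ψ).mono_left nhdsWithin_le_nhds
  simp only [hU0] at key
  exact key

/-! ## §3 On `𝓢`: equicontinuity from orbit continuity (Banach–Steinhaus) -/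

/-- **EQUICONTINUITY OF A CONTINUOUS-ORBIT FAMILY ON THE SCHWARTZ SPACE.**  If `U t` (`t ∈ K`, `K` compact) are continuous linear operators of `𝓢(W, ℂ)` and every
orbit `t ↦ U t Ψ` is continuous on `K`, then for every continuous linear `T : 𝓢 → F` and `ε > 0` some neighbourhood `V` of `0` has `‖T (U t x)‖ < ε` for all
`t ∈ K`, `x ∈ V`: the orbits are bounded in each Schwartz seminorm, so the family is uniformly equicontinuous by Banach–Steinhaus on the barrelled (Fréchet) space
`𝓢` (★ `barrelledSpace_schwartzMap`, Mathlib `WithSeminorms.banach_steinhaus`). [cite: Rudin1991, Thm. 2.6] [cite: Weil1964, Chap. III n° 39 p. 189] -/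
theorem equicontinuous_orbit_schwartz {W : Type*} [NormedAddCommGroup W] [NormedSpace ℝ W]
    {F : Type*} [NormedAddCommGroup F] [NormedSpace ℝ F]
    (U : ℝ → 𝓢(W, ℂ) →L[ℝ] 𝓢(W, ℂ)) (K : Set ℝ) (hK : IsCompact K)
    (hcont : ∀ Ψ : 𝓢(W, ℂ), ContinuousOn (fun t : ℝ => U t Ψ) K)
    (T : 𝓢(W, ℂ) →L[ℝ] F) (ε : ℝ) (hε : 0 < ε) :
    ∃ V ∈ 𝓝 (0 : 𝓢(W, ℂ)), ∀ t ∈ K, ∀ x ∈ V, ‖T (U t x)‖ < ε := by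
  haveI : BarrelledSpace ℝ 𝓢(W, ℂ) := Literature.Analysis.FunctionSpaces.barrelledSpace_schwartzMap
  -- Banach–Steinhaus: `{U t : t ∈ K}` is uniformly equicontinuous (orbits bounded in every Schwartz seminorm)
  have H : ∀ (k : ℕ × ℕ) (x : 𝓢(W, ℂ)), BddAbove (Set.range fun t : K => schwartzSeminormFamily ℝ W ℂ k (U (t : ℝ) x)) := by
    intro k x
    have hc : ContinuousOn (fun t : ℝ => schwartzSeminormFamily ℝ W ℂ k (U t x)) K :=
      ((schwartz_withSeminorms ℝ W ℂ).continuous_seminorm k).comp_continuousOn (hcont x)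
    simpa only [Set.image_eq_range] using hK.bddAbove_image hc
  have hequi : UniformEquicontinuous ((↑) ∘ fun t : K => U (t : ℝ)) :=
    (schwartz_withSeminorms ℝ W ℂ).banach_steinhaus H
  have heq0 : EquicontinuousAt ((↑) ∘ fun t : K => U (t : ℝ)) (0 : 𝓢(W, ℂ)) := hequi.equicontinuous 0
  -- unpack at the entourage `{p | p.2 - p.1 ∈ T⁻¹(ball 0 ε)}`
  have hW : (fun x : 𝓢(W, ℂ) => T x) ⁻¹' Metric.ball 0 ε ∈ 𝓝 (0 : 𝓢(W, ℂ)) :=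
    T.continuous.continuousAt.preimage_mem_nhds (by rw [map_zero]; exact Metric.ball_mem_nhds 0 hε)
  have hent : {p : 𝓢(W, ℂ) × 𝓢(W, ℂ) | p.2 - p.1 ∈ (fun x : 𝓢(W, ℂ) => T x) ⁻¹' Metric.ball 0 ε} ∈ uniformity 𝓢(W, ℂ) := by
    rw [uniformity_eq_comap_nhds_zero 𝓢(W, ℂ)]
    exact Filter.preimage_mem_comap hW
  have hev := heq0 _ hent
  refine ⟨_, hev, fun t ht x hx => ?_⟩
  have h := hx ⟨t, ht⟩
  simpa only [Function.comp_apply, Set.mem_setOf_eq, map_zero, sub_zero, Set.mem_preimage, Metric.mem_ball, dist_zero_right] using h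

/-! ## §4 On `𝓢`: the law at `0` on a dense set closes up to every vector -/

/-- **THE CLOSURE THEOREM ON `𝓢`.**  Let `U t` be a one-parameter group of continuous linear operators of `𝓢(W, ℂ)` (`U (t + s) = U t ∘ U s`, `U 0 = id`) with
continuous orbits `t ↦ U t Ψ`, `A` a continuous linear operator, `D ⊆ 𝓢` DENSE, and suppose the weak derivative law at `0` holds on `D` with derivative `A d`:
`∀ d ∈ D, ∀ T, HasDerivAt (s ↦ T (U s d)) (T (A d)) 0`.  Then it holds at EVERY vector: `HasDerivAt (t ↦ T (U t Ψ)) (T (A Ψ)) 0` (§1 + §3 ⇒ §2).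
[cite: Rudin1991, Thm. 2.6, Thm. 7.17] [cite: Folland1989, §4.2 Prop. (4.39)] -/
theorem hasDerivAt_orbit_schwartz_of_dense {W : Type*} [NormedAddCommGroup W] [NormedSpace ℝ W]
    {F : Type*} [NormedAddCommGroup F] [NormedSpace ℝ F]
    (U : ℝ → 𝓢(W, ℂ) →L[ℝ] 𝓢(W, ℂ)) (hgrp : ∀ (t s : ℝ) (x : 𝓢(W, ℂ)), U (t + s) x = U t (U s x))
    (hU0 : ∀ x : 𝓢(W, ℂ), U 0 x = x) (hcont : ∀ Ψ : 𝓢(W, ℂ), Continuous fun t : ℝ => U t Ψ)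
    (D : Set 𝓢(W, ℂ)) (hD : Dense D) (A : 𝓢(W, ℂ) →L[ℝ] 𝓢(W, ℂ))
    (hlaw : ∀ d ∈ D, ∀ T : 𝓢(W, ℂ) →L[ℝ] F, HasDerivAt (fun s : ℝ => T (U s d)) (T (A d)) 0)
    (Ψ : 𝓢(W, ℂ)) (T : 𝓢(W, ℂ) →L[ℝ] F) :
    HasDerivAt (fun t : ℝ => T (U t Ψ)) (T (A Ψ)) 0 :=
  hasDerivAt_orbit_of_mem_closure U A D (hD Ψ)
    (fun d hd t T' => hasDerivAt_orbit_shift U hgrp (fun T'' => hlaw d hd T'') t T')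
    (fun T' ε hε => equicontinuous_orbit_schwartz U (Set.Icc (-1) 1) isCompact_Icc (fun Ψ' => (hcont Ψ').continuousOn) T' ε hε)
    hU0 T

end Summit.HodgeConjecture.HodgeConjecture.Cruxes.HLiu418.K2LiuArchOrbitDerivClosure

/-! ## §5 The (W-orb) letter of ★ `K2LiuFaceGThetaLetter` from density, the derivative operator on the dense class, and orbit continuity -/

namespace Summit.HodgeConjecture.HodgeConjecture.Cruxes.HLiu418.K2LiuArchOrbitDerivClosure

open NumberField NumberField.mixedEmbedding MeasureTheory IsDedekindDomain
open scoped Matrix TensorProduct Classical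
open Literature.NumberTheory.Automorphic Literature.NumberTheory.Automorphic.UnitaryGroup
open Literature.NumberTheory.Automorphic.IdeleClassGroup
open Literature.NumberTheory.Automorphic.Liu2021
open Literature.NumberTheory.Automorphic.Liu2021.Def411WeilCarriers
open Literature.NumberTheory.Automorphic.Liu2021.Def411WeilCarriersDoubling
open Literature.NumberTheory.GelbartRogawski1991 Literature.NumberTheory.GelbartRogawski1991.UnitaryDualPair
open Literature.NumberTheory.GelbartRogawski1991.GRConstruction
open Literature.NumberTheory.GaloisRepresentations
open Literature.NumberTheory.Weil1964
open Literature.RepresentationTheory.Liu2021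
open Literature.RepresentationTheory.HeisenbergGroup
open Literature.NumberTheory.K2Lit.DoubledLineTheta Literature.NumberTheory.K2Lit.SiegelDoubled
open Summit.HodgeConjecture.HodgeConjecture.Cruxes.HLiu418.K2LiuFaceGThetaLetter (proj_chiSplittingLine_eq_toSp archSkew_diagonal_of_hermD)
open HodgeCM.Model.HypCensus (archWeilRep continuous_archWeilRep)

variable (L : Type) [Field L] [NumberField L] [IsCMField L]
variable {N n : ℕ} (e : Fin N × Fin 1 ≃ Fin n)
  (dV : Fin N → L) (hdV : ∀ i, IsCMField.complexConj L (dV i) = dV i)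
  (dW : Fin 1 → L) (hdW : ∀ i, IsCMField.complexConj L (dW i) = dW i)
  {n'' : ℕ} (e₁ : Fin (n + n) × Fin 1 ≃ Fin n'')
  (hdV0 : ∀ i, dV i ≠ 0) (hdW0 : ∀ i, dW i ≠ 0)
  (lam : IdeleClassGroup L →ₜ* Circle) (hlam : IsConjugateSymplectic L lam) (a' : (Fp L)ˣ)

/-- **(W-orb) FROM DENSITY, THE DERIVATIVE OPERATOR ON THE DENSE CLASS, AND ORBIT CONTINUITY.**  For the small pair's archimedean Weil representation
`ω_∞ = archWeilRep … (chiSplittingLine …) hs` and an arch letter `X`: if `D ⊆ 𝓢(X_∞)` is dense, `A` is a continuous (real-)linear operator of `𝓢(X_∞)` with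
`∀ d ∈ D, ∀ T, HasDerivAt (t ↦ T (ω_∞(exp tX, 1) d)) (T (A d)) 0` (road (B) globalised), and every orbit `t ↦ ω_∞(exp tX, 1) Ψ` is continuous into `𝓢(X_∞)`,
then the `hWorb` letter of ★ `faceG_thetaLetter_of_archOrbitDeriv` holds at EVERY `Ψ_∞` (with `Ψ_∞′ = A Ψ_∞`): §4 at the one-parameter group
`t ↦ ω_∞(exp tX, 1)` (★ `continuous_archWeilRep`, ★ `expGL_add_smul`, ★ `expGL_zero`). [cite: Folland1989, §4.2 Prop. (4.39)] [cite: Rudin1991, Thm. 2.6, Thm. 7.17]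
[cite: Weil1964, Chap. III n° 39 p. 189] -/
theorem thetaOrbitLetter_of_dense {X : Matrix (Fin (n + n)) (Fin (n + n)) (mixedSpace L)}
    (hX : X ∈ archSkew (Fp L) L (IsCMField.complexConj L) (n + n) (hermD L e dV hdV dW hdW))
    (D : Set 𝓢((Fin n'' → mixedSpace (Fp L)), ℂ)) (hD : Dense D)
    (A : 𝓢((Fin n'' → mixedSpace (Fp L)), ℂ) →L[ℝ] 𝓢((Fin n'' → mixedSpace (Fp L)), ℂ))
    (hlaw : ∀ d ∈ D, ∀ T : 𝓢((Fin n'' → mixedSpace (Fp L)), ℂ) →L[ℝ] ℂ,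
      HasDerivAt (fun t : ℝ => T
        (archWeilRep (Fp L) L (IsCMField.complexConj L) (n + n) 1 (Matrix.diagonal (dD L e dV hdV dW hdW)) (JW (Fp L) L a')
            (complexConj_imagUnit L) (imagUnit_ne_zero L) (imagUnit_mul_self L)
            (realDiagonal_isSymm L (dD L e dV hdV dW hdW) (dD_conj L e dV hdV dW hdW)) (isSymm_TW (Fp L) a')
            (isUnit_det_realDiagonal L (dD L e dV hdV dW hdW) (dD_conj L e dV hdV dW hdW) (dD_ne_zero L e dV hdV dW hdW hdV0 hdW0))
            (isUnit_det_TW (Fp L) a') (realDiagonal_map L (dD L e dV hdV dW hdW) (dD_conj L e dV hdV dW hdW)).symm (JW_eq (Fp L) L a') e₁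
            (chiSplittingLine L e₁ (dD L e dV hdV dW hdW) (dD_conj L e dV hdV dW hdW) (dD_ne_zero L e dV hdV dW hdW hdV0 hdW0)
              (toHeckeCharacter L lam) (isUnitary_toHeckeCharacter L lam)
              ((isOscillatorChar_toHeckeCharacter_iff lam).mpr hlam) (TW (Fp L) a')
              (isUnit_det_TW (Fp L) a') (JW (Fp L) L a') (JW_eq (Fp L) L a'))
            (proj_chiSplittingLine_eq_toSp L e dV hdV dW hdW e₁ hdV0 hdW0 lam hlam a')
            (⟨expGL (t • X), expGL_smul_mem_arch (Matrix.diagonal (dD L e dV hdV dW hdW)) (archSkew_diagonal_of_hermD L e dV hdV dW hdW hX) t⟩, 1)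
            d))
        (T (A d)) 0)
    (horb : ∀ Ψ : 𝓢((Fin n'' → mixedSpace (Fp L)), ℂ), Continuous fun t : ℝ =>
        (archWeilRep (Fp L) L (IsCMField.complexConj L) (n + n) 1 (Matrix.diagonal (dD L e dV hdV dW hdW)) (JW (Fp L) L a')
            (complexConj_imagUnit L) (imagUnit_ne_zero L) (imagUnit_mul_self L)
            (realDiagonal_isSymm L (dD L e dV hdV dW hdW) (dD_conj L e dV hdV dW hdW)) (isSymm_TW (Fp L) a')
            (isUnit_det_realDiagonal L (dD L e dV hdV dW hdW) (dD_conj L e dV hdV dW hdW) (dD_ne_zero L e dV hdV dW hdW hdV0 hdW0))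
            (isUnit_det_TW (Fp L) a') (realDiagonal_map L (dD L e dV hdV dW hdW) (dD_conj L e dV hdV dW hdW)).symm (JW_eq (Fp L) L a') e₁
            (chiSplittingLine L e₁ (dD L e dV hdV dW hdW) (dD_conj L e dV hdV dW hdW) (dD_ne_zero L e dV hdV dW hdW hdV0 hdW0)
              (toHeckeCharacter L lam) (isUnitary_toHeckeCharacter L lam)
              ((isOscillatorChar_toHeckeCharacter_iff lam).mpr hlam) (TW (Fp L) a')
              (isUnit_det_TW (Fp L) a') (JW (Fp L) L a') (JW_eq (Fp L) L a'))
            (proj_chiSplittingLine_eq_toSp L e dV hdV dW hdW e₁ hdV0 hdW0 lam hlam a')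
            (⟨expGL (t • X), expGL_smul_mem_arch (Matrix.diagonal (dD L e dV hdV dW hdW)) (archSkew_diagonal_of_hermD L e dV hdV dW hdW hX) t⟩, 1)
            Ψ)) :
    ∀ Ψinf : 𝓢((Fin n'' → mixedSpace (Fp L)), ℂ), ∃ Ψinf' : 𝓢((Fin n'' → mixedSpace (Fp L)), ℂ),
      ∀ T : 𝓢((Fin n'' → mixedSpace (Fp L)), ℂ) →L[ℝ] ℂ,
      HasDerivAt (fun t : ℝ => T
        (archWeilRep (Fp L) L (IsCMField.complexConj L) (n + n) 1 (Matrix.diagonal (dD L e dV hdV dW hdW)) (JW (Fp L) L a')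
            (complexConj_imagUnit L) (imagUnit_ne_zero L) (imagUnit_mul_self L)
            (realDiagonal_isSymm L (dD L e dV hdV dW hdW) (dD_conj L e dV hdV dW hdW)) (isSymm_TW (Fp L) a')
            (isUnit_det_realDiagonal L (dD L e dV hdV dW hdW) (dD_conj L e dV hdV dW hdW) (dD_ne_zero L e dV hdV dW hdW hdV0 hdW0))
            (isUnit_det_TW (Fp L) a') (realDiagonal_map L (dD L e dV hdV dW hdW) (dD_conj L e dV hdV dW hdW)).symm (JW_eq (Fp L) L a') e₁
            (chiSplittingLine L e₁ (dD L e dV hdV dW hdW) (dD_conj L e dV hdV dW hdW) (dD_ne_zero L e dV hdV dW hdW hdV0 hdW0)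
              (toHeckeCharacter L lam) (isUnitary_toHeckeCharacter L lam)
              ((isOscillatorChar_toHeckeCharacter_iff lam).mpr hlam) (TW (Fp L) a')
              (isUnit_det_TW (Fp L) a') (JW (Fp L) L a') (JW_eq (Fp L) L a'))
            (proj_chiSplittingLine_eq_toSp L e dV hdV dW hdW e₁ hdV0 hdW0 lam hlam a')
            (⟨expGL (t • X), expGL_smul_mem_arch (Matrix.diagonal (dD L e dV hdV dW hdW)) (archSkew_diagonal_of_hermD L e dV hdV dW hdW hX) t⟩, 1)
            Ψinf))
        (T Ψinf') 0 := by
  intro Ψinf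
  refine ⟨A Ψinf, fun T => ?_⟩
  have hadd : ∀ t s : ℝ,
      ((⟨expGL ((t + s) • X), expGL_smul_mem_arch (Matrix.diagonal (dD L e dV hdV dW hdW))
          (archSkew_diagonal_of_hermD L e dV hdV dW hdW hX) (t + s)⟩, 1) :
        UnitaryGroup.arch (Fp L) L (IsCMField.complexConj L) (n + n) (Matrix.diagonal (dD L e dV hdV dW hdW)) ×
          UnitaryGroup.arch (Fp L) L (IsCMField.complexConj L) 1 (JW (Fp L) L a')) =
      (⟨expGL (t • X), expGL_smul_mem_arch (Matrix.diagonal (dD L e dV hdV dW hdW)) (archSkew_diagonal_of_hermD L e dV hdV dW hdW hX) t⟩, 1) *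
        (⟨expGL (s • X), expGL_smul_mem_arch (Matrix.diagonal (dD L e dV hdV dW hdW)) (archSkew_diagonal_of_hermD L e dV hdV dW hdW hX) s⟩, 1) :=
    fun t s => Prod.ext (Subtype.ext (expGL_add_smul t s X)) (mul_one _).symm
  have hzero : ((⟨expGL ((0 : ℝ) • X), expGL_smul_mem_arch (Matrix.diagonal (dD L e dV hdV dW hdW))
          (archSkew_diagonal_of_hermD L e dV hdV dW hdW hX) 0⟩, 1) :
        UnitaryGroup.arch (Fp L) L (IsCMField.complexConj L) (n + n) (Matrix.diagonal (dD L e dV hdV dW hdW)) ×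
          UnitaryGroup.arch (Fp L) L (IsCMField.complexConj L) 1 (JW (Fp L) L a')) = 1 :=
    Prod.ext (Subtype.ext (show expGL ((0 : ℝ) • X) = 1 by rw [zero_smul, expGL_zero])) rfl
  -- §4 at the one-parameter group `t ↦ ω_∞(exp tX, 1)` read as continuous real-linear operators of `𝓢(X_∞)` (★ `continuous_archWeilRep`)
  refine hasDerivAt_orbit_schwartz_of_dense (fun t : ℝ =>
    ⟨LinearMap.restrictScalars ℝ
        (archWeilRep (Fp L) L (IsCMField.complexConj L) (n + n) 1 (Matrix.diagonal (dD L e dV hdV dW hdW)) (JW (Fp L) L a')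
            (complexConj_imagUnit L) (imagUnit_ne_zero L) (imagUnit_mul_self L)
            (realDiagonal_isSymm L (dD L e dV hdV dW hdW) (dD_conj L e dV hdV dW hdW)) (isSymm_TW (Fp L) a')
            (isUnit_det_realDiagonal L (dD L e dV hdV dW hdW) (dD_conj L e dV hdV dW hdW) (dD_ne_zero L e dV hdV dW hdW hdV0 hdW0))
            (isUnit_det_TW (Fp L) a') (realDiagonal_map L (dD L e dV hdV dW hdW) (dD_conj L e dV hdV dW hdW)).symm (JW_eq (Fp L) L a') e₁
            (chiSplittingLine L e₁ (dD L e dV hdV dW hdW) (dD_conj L e dV hdV dW hdW) (dD_ne_zero L e dV hdV dW hdW hdV0 hdW0)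
              (toHeckeCharacter L lam) (isUnitary_toHeckeCharacter L lam)
              ((isOscillatorChar_toHeckeCharacter_iff lam).mpr hlam) (TW (Fp L) a')
              (isUnit_det_TW (Fp L) a') (JW (Fp L) L a') (JW_eq (Fp L) L a'))
            (proj_chiSplittingLine_eq_toSp L e dV hdV dW hdW e₁ hdV0 hdW0 lam hlam a')
          (⟨expGL (t • X), expGL_smul_mem_arch (Matrix.diagonal (dD L e dV hdV dW hdW)) (archSkew_diagonal_of_hermD L e dV hdV dW hdW hX) t⟩, 1)),
      continuous_archWeilRep (Fp L) L (IsCMField.complexConj L) (n + n) 1 (Matrix.diagonal (dD L e dV hdV dW hdW)) (JW (Fp L) L a')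
        (complexConj_imagUnit L) (imagUnit_ne_zero L) (imagUnit_mul_self L)
        (realDiagonal_isSymm L (dD L e dV hdV dW hdW) (dD_conj L e dV hdV dW hdW)) (isSymm_TW (Fp L) a')
        (isUnit_det_realDiagonal L (dD L e dV hdV dW hdW) (dD_conj L e dV hdV dW hdW) (dD_ne_zero L e dV hdV dW hdW hdV0 hdW0))
        (isUnit_det_TW (Fp L) a') (realDiagonal_map L (dD L e dV hdV dW hdW) (dD_conj L e dV hdV dW hdW)).symm (JW_eq (Fp L) L a') e₁
        (chiSplittingLine L e₁ (dD L e dV hdV dW hdW) (dD_conj L e dV hdV dW hdW) (dD_ne_zero L e dV hdV dW hdW hdV0 hdW0)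
          (toHeckeCharacter L lam) (isUnitary_toHeckeCharacter L lam)
          ((isOscillatorChar_toHeckeCharacter_iff lam).mpr hlam) (TW (Fp L) a')
          (isUnit_det_TW (Fp L) a') (JW (Fp L) L a') (JW_eq (Fp L) L a'))
        (proj_chiSplittingLine_eq_toSp L e dV hdV dW hdW e₁ hdV0 hdW0 lam hlam a')
        (⟨expGL (t • X), expGL_smul_mem_arch (Matrix.diagonal (dD L e dV hdV dW hdW)) (archSkew_diagonal_of_hermD L e dV hdV dW hdW hX) t⟩, 1)⟩)
    (fun t s x => ?_) (fun x => ?_) horb D hD A hlaw Ψinf T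
  · simp only [ContinuousLinearMap.coe_mk', LinearMap.coe_restrictScalars]
    rw [hadd, map_mul, Module.End.mul_apply]
  · simp only [ContinuousLinearMap.coe_mk', LinearMap.coe_restrictScalars]
    rw [hzero, map_one, Module.End.one_apply]

end Summit.HodgeConjecture.HodgeConjecture.Cruxes.HLiu418.K2LiuArchOrbitDerivClosure

end
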